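import Summits.Ventures.PercRepro.C041TriangleStar2Star3Coef1
import Summits.Ventures.PercRepro.C041TriangleStar2Star3Coef10
import Summits.Ventures.PercRepro.C041TriangleStar2Star3Coef11
import Summits.Ventures.PercRepro.C041TriangleStar2Star3Coef12
import Summits.Ventures.PercRepro.C041TriangleStar2Star3Coef13
import Summits.Ventures.PercRepro.C041TriangleStar2Star3Coef14
import Summits.Ventures.PercRepro.C041TriangleStar2Star3Coef15
import Summits.Ventures.PercRepro.C041TriangleStar2Star3Coef16
import Summits.Ventures.PercRepro.C041TriangleStar2Star3Coef17
import Summits.Ventures.PercRepro.C041TriangleStar2Star3Coef18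
import Summits.Ventures.PercRepro.C041TriangleStar2Star3Coef19
import Summits.Ventures.PercRepro.C041TriangleStar2Star3Coef2
import Summits.Ventures.PercRepro.C041TriangleStar2Star3Coef20
import Summits.Ventures.PercRepro.C041TriangleStar2Star3Coef21
import Summits.Ventures.PercRepro.C041TriangleStar2Star3Coef22
import Summits.Ventures.PercRepro.C041TriangleStar2Star3Coef23
import Summits.Ventures.PercRepro.C041TriangleStar2Star3Coef24
import Summits.Ventures.PercRepro.C041TriangleStar2Star3Coef25
import Summits.Ventures.PercRepro.C041TriangleStar2Star3Coef26
import Summits.Ventures.PercRepro.C041TriangleStar2Star3Coef27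
import Summits.Ventures.PercRepro.C041TriangleStar2Star3Coef28
import Summits.Ventures.PercRepro.C041TriangleStar2Star3Coef29
import Summits.Ventures.PercRepro.C041TriangleStar2Star3Coef3
import Summits.Ventures.PercRepro.C041TriangleStar2Star3Coef30
import Summits.Ventures.PercRepro.C041TriangleStar2Star3Coef4
import Summits.Ventures.PercRepro.C041TriangleStar2Star3Coef5
import Summits.Ventures.PercRepro.C041TriangleStar2Star3Coef6
import Summits.Ventures.PercRepro.C041TriangleStar2Star3Coef7
import Summits.Ventures.PercRepro.C041TriangleStar2Star3Coef8
import Summits.Ventures.PercRepro.C041TriangleStar2Star3Coef9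

/-!
# THEOREM (TWO-LEAF STAR × THREE-LEAF STAR) — the symmetric-monomial sums used by the normal forms of the group lemmas (mine-3, gen 68; C-041.md §21 (bi))
-/

namespace PercRepro

namespace RelaxedTriangle

open TreeClosure

/-- `star2Star3Sym e₁ … k… x… = (Π free^k) · Σ_{π ∈ G} (the permuted monomial)`: the sum of a monomial over the leaf symmetry group
`G` (every monomial of a class is counted `|Stab|` times). -/
noncomputable def star2Star3Sym (e1 e2 e3 e4 e5 : ℕ) (a b c d e : ℝ) : ℝ :=
  (a ^ e1 * b ^ e2 * c ^ e3 * d ^ e4 * e ^ e5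
    + a ^ e1 * b ^ e2 * c ^ e3 * e ^ e4 * d ^ e5
    + a ^ e1 * b ^ e2 * d ^ e3 * c ^ e4 * e ^ e5
    + a ^ e1 * b ^ e2 * d ^ e3 * e ^ e4 * c ^ e5
    + a ^ e1 * b ^ e2 * e ^ e3 * c ^ e4 * d ^ e5
    + a ^ e1 * b ^ e2 * e ^ e3 * d ^ e4 * c ^ e5
    + b ^ e1 * a ^ e2 * c ^ e3 * d ^ e4 * e ^ e5
    + b ^ e1 * a ^ e2 * c ^ e3 * e ^ e4 * d ^ e5
    + b ^ e1 * a ^ e2 * d ^ e3 * c ^ e4 * e ^ e5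
    + b ^ e1 * a ^ e2 * d ^ e3 * e ^ e4 * c ^ e5
    + b ^ e1 * a ^ e2 * e ^ e3 * c ^ e4 * d ^ e5
    + b ^ e1 * a ^ e2 * e ^ e3 * d ^ e4 * c ^ e5)

end RelaxedTriangle

end PercRepro
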